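import Literature.Barriers.ValiantsHypothesis.BILPS19MembershipHardness
import Literature.Computability.Complexity.CanonicalCodes
import Literature.Computability.Complexity.CodeFPBudgets
import HarnessLib

/-!
# Bläser–Ikenmeyer–Lysikov–Pandey–Schreyer 2019, Thm 34, first half: `HMinRank1 ≤ₚ HQuad` — proofs

Sibling proof file of `BILPS19MembershipHardness.lean` (val-lit X5, §8). BILPS Thm 34 ("Let `F` be a
field and `K` be an effective subfield of `F`. Then `HMinRank1_{K,F}` is polynomial-time equivalent
to `HQuad_{K,F}`", arXiv:1911.02534 p0033:L77) is typed in the tree as the conjunction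
`BILPS2019_thm34 F : hmr1Language F ≤ₚ hquadZLanguage F ∧ hquadZLanguage F ≤ₚ hmr1Language F` of two
Karp reductions between the integer-entry problems (module docstring (2) of the statement file).
This file proves the FIRST reduction, exactly along the printed route ("`rk(Tx) ≤ 1` if and only if
all `2 × 2` minors of `Tx` vanish, so `HMinRank1` is a special case of `HQuad`", p0033:L80–82), for
EVERY field `F`; the second reduction and the discharge `BILPS2019_thm34_holds` are the sibling
`BILPS19HQuadToHMinRank1Proofs.lean`.

* §0 (generic, reused by the sibling): `BILPS19Thm34.karpReducible_of_decoder` — a Karp reduction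
  `eα.toLanguage S ≤ₚ eβ.toLanguage T` from (i) a TOTAL decoder `dec` of the source code with
  `dec (encode a) = a` whose re-encoding `encode ∘ dec` is a polynomial-time string function
  (`CodeFP strE eα.encode dec`), (ii) an instance map `g` computed on codes (`CodeFP`), correct on
  instances (`a ∈ S ↔ g a ∈ T`), and (iii) a fixed non-member of `T` for the non-codes.
* §D (decoders): the total decoders of the two instance codes `tensorInstEncoding`
  (`(n, k, entries, r)`) and `hquadInstEncoding` (`(n, forms)`) and their polynomial-time
  re-encodings, assembled from `CanonicalCodes.lean` (`Brick.canonF`, `CanonCode.canonIntFn`,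
  `canonListFn`, `canonListFnC`).
* §A (the printed reduction): for an instance `(n, k, l, 1)` with `|l| = k n²` and `k ≥ 1` the
  `HQuad_ℤ` instance in the `k` unknowns `x_1, …, x_k` whose forms are the `2 × 2` minors of
  `Tx = Σ_a x_a A_a` — one form per quadruple `(i, i', j, j') ∈ [n]⁴` (code `q < n⁴`), coefficient of
  `x_a x_b` equal to `A_a[i,j] A_b[i',j'] − A_a[i,j'] A_b[i',j]` (`BILPS19Thm34.minorForm`,
  `quadFormOfList_minorForm`); `k = 0` (no nonzero `x`), `r ≠ 1` and ill-formed lists go to the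
  fixed non-member `(1, [[1]])`. Correctness `BILPS19Thm34.mem_hmr1Set_iff_reduceA_mem` by "rank
  `≤ 1` iff all `2 × 2` minors vanish" (`Literature.LinearAlgebra.Matrix.rank_le_iff_det_submatrix_eq_zero`).
* §M (the machine): the instance map in the typed `CodeFP` algebra (`CodeFP.lean`, `CodeFPArith.lean`,
  `CodeFPBudgets.lean`): entries read by `rawGetOr`, products/differences in the difference-pair
  integer code (`intOfSM`, `intMul`, `intSub`, `smOfInt`), the two tables as `brange`/`map` loops
  under the unary budget `(|l| + 2)²`; `BILPS19Thm34.reduceAFP`.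
* §R: **`BILPS19Thm34.hmr1Language_karpReducible_hquadZLanguage : hmr1Language F ≤ₚ hquadZLanguage F`**.

Theorem-only file (its `def`s are proof plumbing: decoders, tables, the instance map; no statement
of `BILPS19MembershipHardness.lean` is touched, no new fact). HONEST FRAMING (val-lit): typed
literature; `VP ≠ VNP` is NOT proved and nothing here is progress on it.

## References

* [BlaserIkenmeyerLysikovPandeySchreyer2019] M. Bläser, C. Ikenmeyer, V. Lysikov, A. Pandey,
  F.-O. Schreyer, *Variety membership testing, algebraic natural proofs, and geometric complexity
  theory*, arXiv:1911.02534, §8.1, Problems 2–4, Thm. 32 and Thm. 34 (p0032:L36, p0033:L1–L10,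
  L77–L93).
* [AroraBarak2009] S. Arora, B. Barak, *Computational Complexity: A Modern Approach*, CUP 2009,
  Def. 2.7 (Karp reductions), §1.3 (polynomial time: composition, bounded loops), §0.1 (codes).
-/

noncomputable section

namespace Literature.Barriers.ValiantsHypothesis

open Literature.Computability.AlgebraicComplexity Literature.Computability.Complexity
open _root_.Computability
open scoped Literature.Computability.Complexity.Notation

universe u

namespace BILPS19Thm34

open CodeFP Brick CanonCode

/-! ### §0. Karp reductions from a polynomial-time decoder and a typed instance map -/

section Generic

variable {α β : Type}

/-- **A Karp reduction between encoded problems from a decoder and a typed instance map.** If the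
source code has a total decoder `dec` (`dec (encode a) = a`) whose re-encoding `encode ∘ dec` is a
polynomial-time string function, the instance map `g` is computed on codes and is correct on
instances, and `bad ∉ T`, then `w ↦ encode (g (dec w))` on canonical codes (`encode (dec w) = w`),
`w ↦ encode bad` elsewhere, is a polynomial-time many-one reduction.
[cite: AroraBarak2009, Def. 2.7 and §1.3] -/
theorem karpReducible_of_decoder (eα : Encoding α Bool) (eβ : Encoding β Bool)
    {dec : List Bool → α} (hdec : ∀ a, dec (eα.encode a) = a) (hdecFP : CodeFP strE eα.encode dec)
    {g : α → β} (hg : CodeFP eα.encode eβ.encode g) {S : Set α} {T : Set β}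
    (hST : ∀ a, a ∈ S ↔ g a ∈ T) {bad : β} (hbad : bad ∉ T) :
    eα.toLanguage S ≤ₚ eβ.toLanguage T := by
  classical
  have hre : CodeFP strE strE (fun w => eα.encode (dec w)) := hdecFP.recodeOut fun _ => rfl
  have htest : CodeFP strE bitE (fun w => decide (eα.encode (dec w) = w)) :=
    ((CodeFP.eq (eα := strE) fun _ _ h => h).comp (hre.pair (CodeFP.id strE))).congr fun _ => rfl
  have hout : CodeFP strE strE (fun w => eβ.encode (g (dec w))) :=
    (hg.comp hdecFP).recodeOut fun _ => rfl
  obtain ⟨f, hf, hfF⟩ := htest.ite hout (const strE (eβ.encode bad))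
  refine ⟨f, hf, fun w => ?_⟩
  have hfw : f w = if decide (eα.encode (dec w) = w) then eβ.encode (g (dec w)) else eβ.encode bad :=
    hfF w
  show w ∈ eα.toLanguage S ↔ f w ∈ eβ.toLanguage T
  rw [hfw]
  by_cases hw : eα.encode (dec w) = w
  · rw [decide_eq_true hw, if_pos rfl, Encoding.mem_toLanguage_iff, ← hST, ← hw,
      Encoding.mem_toLanguage_iff, hdec]
  · rw [decide_eq_false hw]
    refine ⟨fun h => ?_, fun h => ?_⟩
    · obtain ⟨a, -, rfl⟩ := h
      exact (hw (by rw [hdec])).elim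
    · exact (hbad ((Encoding.mem_toLanguage_iff eβ T bad).1 h)).elim

end Generic

/-! ### §D. Total decoders of the two instance codes, and their polynomial-time re-encodings -/

section Decoders

/-- The list of integers read off a headed-list string by the tree's decoder (`|header|` items).
[cite: AroraBarak2009, §0.1] -/
def decIntList (u : List Bool) : List ℤ :=
  NegCNF.decList decInt (boolUnpair u).1.length (boolUnpair u).2

/-- The list of integer lists read off a headed-list string. [cite: AroraBarak2009, §0.1] -/
def decIntListList (u : List Bool) : List (List ℤ) :=
  NegCNF.decList decIntList (boolUnpair u).1.length (boolUnpair u).2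

/-- **The total decoder of `HMinRank` instance codes** `(n, k, entries, r)` (`tensorInstEncoding`).
[cite: BlaserIkenmeyerLysikovPandeySchreyer2019, Problem 2 (input)] -/
def decT (w : List Bool) : ℕ × ℕ × List ℤ × ℕ :=
  (decodeNat (boolUnpair w).1, decodeNat (boolUnpair (boolUnpair w).2).1,
    decIntList (boolUnpair (boolUnpair (boolUnpair w).2).2).1,
    decodeNat (boolUnpair (boolUnpair (boolUnpair w).2).2).2)

/-- **The total decoder of `HQuad` instance codes** `(n, forms)` (`hquadInstEncoding`).
[cite: BlaserIkenmeyerLysikovPandeySchreyer2019, Problem 4 (input)] -/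
def decQ (w : List Bool) : ℕ × List (List ℤ) :=
  (decodeNat (boolUnpair w).1, decIntListList (boolUnpair w).2)

/-- The code of an `HMinRank` instance, in the `CodeFP` encoders. [cite: AroraBarak2009, §0.1] -/
def instE : ℕ × ℕ × List ℤ × ℕ → List Bool := pairE natE (pairE natE (pairE (listE smE) natE))

/-- `instE` is `tensorInstEncoding.encode`. [cite: AroraBarak2009, §0.1] -/
theorem instE_eq : (tensorInstEncoding.encode : ℕ × ℕ × List ℤ × ℕ → List Bool) = instE := by
  unfold instE tensorInstEncoding smE
  rw [pairE_eq, pairE_eq, pairE_eq, listE_eq, natE_eq]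

/-- The code of an `HQuad` instance, in the `CodeFP` encoders. [cite: AroraBarak2009, §0.1] -/
def quadE : ℕ × List (List ℤ) → List Bool := pairE natE (listE (listE smE))

/-- `quadE` is `hquadInstEncoding.encode`. [cite: AroraBarak2009, §0.1] -/
theorem quadE_eq : (hquadInstEncoding.encode : ℕ × List (List ℤ) → List Bool) = quadE := by
  unfold quadE hquadInstEncoding smE
  rw [pairE_eq, listE_eq, listE_eq, natE_eq]

/-- The total integer decoder reads back sign–magnitude codes. [folklore] -/
private theorem decInt_smE (z : ℤ) : decInt (smE z) = z := by
  have h := decode_int (smE z)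
  rw [show smE z = encodingIntBool.encode z from rfl, encodingIntBool.decode_encode] at h
  exact (Option.some.inj h).symm

/-- `decIntList` reads back headed lists of sign–magnitude integers. [folklore] -/
private theorem decIntList_listE (l : List ℤ) : decIntList (listE smE l) = l := by
  have key : ∀ l : List ℤ, NegCNF.decList decInt l.length (rawE smE l) = l := by
    intro l
    induction l with
    | nil => rfl
    | cons z l ih =>
      rw [List.length_cons, NegCNF.decList, rawE_cons, boolUnpair_boolPair]
      simp only [ih, decInt_smE]
  rw [decIntList, listE, boolUnpair_boolPair, length_unE, key]

/-- `decIntListList` reads back headed lists of headed integer lists. [folklore] -/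
private theorem decIntListList_listE (L : List (List ℤ)) : decIntListList (listE (listE smE) L) = L := by
  have key : ∀ L : List (List ℤ), NegCNF.decList decIntList L.length (rawE (listE smE) L) = L := by
    intro L
    induction L with
    | nil => rfl
    | cons l L ih =>
      rw [List.length_cons, NegCNF.decList, rawE_cons, boolUnpair_boolPair]
      simp only [ih, decIntList_listE]
  rw [decIntListList, listE, boolUnpair_boolPair, length_unE, key]

/-- `decT` inverts the instance code. [cite: AroraBarak2009, §0.1] -/
theorem decT_instE (x : ℕ × ℕ × List ℤ × ℕ) : decT (instE x) = x := by
  obtain ⟨n, k, l, r⟩ := x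
  simp only [decT, instE, pairE_apply, boolUnpair_boolPair, natE, decode_encodeNat, decIntList_listE]

/-- `decQ` inverts the instance code. [cite: AroraBarak2009, §0.1] -/
theorem decQ_quadE (x : ℕ × List (List ℤ)) : decQ (quadE x) = x := by
  obtain ⟨n, L⟩ := x
  simp only [decQ, quadE, pairE_apply, boolUnpair_boolPair, natE, decode_encodeNat, decIntListList_listE]

/-- Naturals are read in polynomial time: `Brick.canonF = natE ∘ decodeNat`. [folklore] -/
private theorem decodeNat_codeFP : CodeFP strE natE decodeNat :=
  of_fn canonF canonF_mem_FP fun w => canonF_eq_encodeNat_decodeNat w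

/-- The two halves of a string under `boolUnpair` are the bricks `fstF`, `sndF`. [folklore] -/
private theorem unpairFst_codeFP : CodeFP strE strE (fun w => (boolUnpair w).1) := of_fn fstF fstF_mem_FP fun _ => rfl

/-- The two halves of a string under `boolUnpair` are the bricks `fstF`, `sndF`. [folklore] -/
private theorem unpairSnd_codeFP : CodeFP strE strE (fun w => (boolUnpair w).2) := of_fn sndF sndF_mem_FP fun _ => rfl

/-- Integer lists are read in polynomial time: `canonListFn canonIntFn` re-encodes. [cite: AroraBarak2009, §1.3] -/
theorem decIntList_codeFP : CodeFP strE (listE smE) decIntList :=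
  of_fn (canonListFn canonIntFn) (canonListFn_mem_FP canonIntFn_mem_FP length_canonIntFn_le) fun u => by
    change canonListFn canonIntFn u = _
    rw [(canonListFn_eq encodingIntBool decInt decode_int canonIntFn_eq u).2, listE_eq]; rfl

/-- `canonListFn canonIntFn` is linearly bounded: `≤ 8 |u| + 2`. [folklore] -/
private theorem length_canonListFn_canonIntFn_le (u : List Bool) :
    (canonListFn canonIntFn u).length ≤ 8 * u.length + 2 := by
  rw [canonListFn_apply]
  exact length_listCanon_le (A := 1) (B := 5) (fun v => by have := length_canonIntFn_le v; omega) u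

/-- Lists of integer lists are read in polynomial time: the clipped loop `canonListFnC 10` over
`canonListFn canonIntFn` re-encodes. [cite: AroraBarak2009, §1.3] -/
theorem decIntListList_codeFP : CodeFP strE (listE (listE smE)) decIntListList :=
  of_fn (canonListFnC 10 (canonListFn canonIntFn))
    (canonListFnC_mem_FP 10 (canonListFn_mem_FP canonIntFn_mem_FP length_canonIntFn_le)) fun u => by
    change canonListFnC 10 (canonListFn canonIntFn) u = _
    have hd : ∀ v, encodingIntBool.listBool.decode v = some (decIntList v) := fun v =>
      (canonListFn_eq encodingIntBool decInt decode_int canonIntFn_eq v).1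
    have hc : ∀ v, canonListFn canonIntFn v = encodingIntBool.listBool.encode (decIntList v) := fun v =>
      (canonListFn_eq encodingIntBool decInt decode_int canonIntFn_eq v).2
    rw [(canonListFnC_eq encodingIntBool.listBool decIntList hd hc length_canonListFn_canonIntFn_le
      (by norm_num) u).2, listE_eq, listE_eq]
    rfl

/-- **The re-encoding `instE ∘ decT` is a polynomial-time string function.** [cite: AroraBarak2009, §1.3] -/
theorem decT_codeFP : CodeFP strE instE decT := by
  have h1 : CodeFP strE natE (fun w => decodeNat (boolUnpair w).1) := decodeNat_codeFP.comp unpairFst_codeFP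
  have hr : CodeFP strE strE (fun w => (boolUnpair w).2) := unpairSnd_codeFP
  have h2 : CodeFP strE natE (fun w => decodeNat (boolUnpair (boolUnpair w).2).1) :=
    decodeNat_codeFP.comp (unpairFst_codeFP.comp hr)
  have hr2 : CodeFP strE strE (fun w => (boolUnpair (boolUnpair w).2).2) := unpairSnd_codeFP.comp hr
  have h3 : CodeFP strE (listE smE) (fun w => decIntList (boolUnpair (boolUnpair (boolUnpair w).2).2).1) :=
    decIntList_codeFP.comp (unpairFst_codeFP.comp hr2)
  have h4 : CodeFP strE natE (fun w => decodeNat (boolUnpair (boolUnpair (boolUnpair w).2).2).2) :=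
    decodeNat_codeFP.comp (unpairSnd_codeFP.comp hr2)
  exact (h1.pair (h2.pair (h3.pair h4))).congr fun _ => rfl

/-- **The re-encoding `quadE ∘ decQ` is a polynomial-time string function.** [cite: AroraBarak2009, §1.3] -/
theorem decQ_codeFP : CodeFP strE quadE decQ :=
  ((decodeNat_codeFP.comp unpairFst_codeFP).pair (decIntListList_codeFP.comp unpairSnd_codeFP)).congr
    fun _ => rfl

end Decoders

/-! ### §A. The printed reduction: the `2 × 2` minors of `Tx` as quadratic forms in `x` -/

section ReductionA

variable (F : Type u) [Field F]

/-- The set of `HMinRank1` yes-instances `(n, k, entries, 1)` read in `F` (the set whose code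
language is `hmr1Language F`). [cite: BlaserIkenmeyerLysikovPandeySchreyer2019, Problem 3] -/
def hmr1Set : Set (ℕ × ℕ × List ℤ × ℕ) :=
  {x | HMRWellFormed x ∧ x.2.2.2 = 1 ∧
    hmrTensorOfList F x.1 x.2.1 x.2.2.1 ∈ (minrankSet F 1 : Set (Fin x.2.1 → Fin x.1 → Fin x.1 → F))}

/-- `hmr1Language` is the code language of `hmr1Set`. [cite: BlaserIkenmeyerLysikovPandeySchreyer2019, Problem 3] -/
theorem hmr1Language_eq : hmr1Language F = tensorInstEncoding.toLanguage (hmr1Set F) := rfl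

/-- The set of `HQuad_ℤ` yes-instances `(n, forms)` read in `F` (the set whose code language is
`hquadZLanguage F`). [cite: BlaserIkenmeyerLysikovPandeySchreyer2019, Problem 4] -/
def hquadZSet : Set (ℕ × List (List ℤ)) :=
  {x | (∀ l ∈ x.2, l.length = x.1 ^ 2) ∧ ∃ v : Fin x.1 → F, v ≠ 0 ∧ ∀ l ∈ x.2, quadFormOfList F x.1 l v = 0}

/-- `hquadZLanguage` is the code language of `hquadZSet`. [cite: BlaserIkenmeyerLysikovPandeySchreyer2019, Problem 4] -/
theorem hquadZLanguage_eq : hquadZLanguage F = hquadInstEncoding.toLanguage (hquadZSet F) := rfl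

/-- Entry `A_a[i, j]` of the slice list `l` of an instance `(n, k, l, r)` (slice `a`, row `i`,
column `j` at position `a n² + i n + j`; missing entries `0`), as an integer.
[cite: BlaserIkenmeyerLysikovPandeySchreyer2019, Problem 2 (input)] -/
def tEntry (n : ℕ) (l : List ℤ) (a i j : ℕ) : ℤ := l.getD (a * n ^ 2 + i * n + j) 0

/-- **The coefficient of `x_a x_b` in the `2 × 2` minor of `Tx = Σ_a x_a A_a` on rows `i, i'` and
columns `j, j'`**: `A_a[i,j] A_b[i',j'] − A_a[i,j'] A_b[i',j]` ("`rk(Tx) ≤ 1` if and only if all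
`2 × 2` minors of `Tx` vanish", p0033:L80). [cite: BlaserIkenmeyerLysikovPandeySchreyer2019, Thm. 34 (proof)] -/
def minorCoeff (n : ℕ) (l : List ℤ) (i i' j j' a b : ℕ) : ℤ :=
  tEntry n l a i j * tEntry n l b i' j' - tEntry n l a i j' * tEntry n l b i' j

/-- **The minor on the quadruple `(i, i', j, j') = (q / n³, q / n² mod n, q / n mod n, q mod n)`
coded by `q < n⁴`, as a quadratic form in the `k` unknowns**: its `k × k` row-major coefficient
list (the input format of `HQuad`, `quadFormOfList`). [cite: BlaserIkenmeyerLysikovPandeySchreyer2019, Thm. 34 (proof)] -/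
def minorForm (n k : ℕ) (l : List ℤ) (q : ℕ) : List ℤ :=
  (List.range (k ^ 2)).map fun s =>
    minorCoeff n l (q / n ^ 3) (q / n ^ 2 % n) (q / n % n) (q % n) (s / k) (s % k)

/-- **The `HQuad_ℤ` instance of an `HMinRank1` instance `(n, k, l, r)`**: `k` unknowns and the `n⁴`
minor forms. [cite: BlaserIkenmeyerLysikovPandeySchreyer2019, Thm. 34 (proof)] -/
def instA (x : ℕ × ℕ × List ℤ × ℕ) : ℕ × List (List ℤ) :=
  (x.2.1, (List.range (x.1 ^ 4)).map (minorForm x.1 x.2.1 x.2.2.1))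

/-- Every minor form has `k²` coefficients. [cite: BlaserIkenmeyerLysikovPandeySchreyer2019, Problem 4 (input)] -/
@[simp] theorem length_minorForm (n k : ℕ) (l : List ℤ) (q : ℕ) : (minorForm n k l q).length = k ^ 2 := by
  simp [minorForm]

/-- The fixed non-member of `HQuad_ℤ`: one unknown and the form `x_1²` (no nontrivial zero).
[cite: BlaserIkenmeyerLysikovPandeySchreyer2019, Problem 4] -/
def badA : ℕ × List (List ℤ) := (1, [[1]])

/-- The guard of the reduction: well-formed entry list, bound `r = 1`, and at least one slice
(`k = 0` has no nonzero `x ∈ F^k`, hence is a no-instance). [cite: BlaserIkenmeyerLysikovPandeySchreyer2019, Problem 3] -/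
def guardA (x : ℕ × ℕ × List ℤ × ℕ) : Bool :=
  decide (x.2.2.1.length = x.2.1 * x.1 ^ 2) && decide (x.2.2.2 = 1) && !decide (x.2.1 = 0)

/-- **The instance map `HMinRank1 → HQuad_ℤ`** on all instances. [cite: BlaserIkenmeyerLysikovPandeySchreyer2019, Thm. 34 (proof)] -/
def reduceA (x : ℕ × ℕ × List ℤ × ℕ) : ℕ × List (List ℤ) := if guardA x then instA x else badA

/-- Items of a tabulated list. [folklore] -/
private theorem getD_map_range (f : ℕ → ℤ) {m s : ℕ} (hs : s < m) : ((List.range m).map f).getD s 0 = f s := by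
  rw [List.getD_eq_getElem _ _ (by simpa using hs)]
  simp

/-- Row-major positions decode: `(a k + b) / k = a`, `(a k + b) mod k = b` for `b < k`. [folklore] -/
private theorem rowMajor_div_mod {k a b : ℕ} (hb : b < k) : (a * k + b) / k = a ∧ (a * k + b) % k = b := by
  have hk : 0 < k := by omega
  constructor
  · rw [Nat.add_comm, Nat.add_mul_div_right _ _ hk, Nat.div_eq_of_lt hb, Nat.zero_add]
  · rw [Nat.add_comm, Nat.add_mul_mod_self_right, Nat.mod_eq_of_lt hb]

/-- Row-major positions are in range: `a k + b < m k` for `a < m`, `b < k`. [folklore] -/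
private theorem rowMajor_lt {k m a b : ℕ} (ha : a < m) (hb : b < k) : a * k + b < m * k := by
  calc a * k + b < a * k + k := by omega
    _ = (a + 1) * k := by ring
    _ ≤ m * k := Nat.mul_le_mul_right _ ha

/-- **The value of the minor form at `x ∈ F^k` is the minor of `Tx`**:
`A[i,j] A[i',j'] − A[i,j'] A[i',j]` with `A = Tx` (`contract3`) and `(i, i', j, j')` the quadruple
coded by `q`. [cite: BlaserIkenmeyerLysikovPandeySchreyer2019, Thm. 34 (proof)] -/
theorem quadFormOfList_minorForm (n k : ℕ) (l : List ℤ) (q : ℕ) (y : Fin k → F) {i i' j j' : Fin n}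
    (hi : i.1 = q / n ^ 3) (hi' : i'.1 = q / n ^ 2 % n) (hj : j.1 = q / n % n) (hj' : j'.1 = q % n) :
    quadFormOfList F k (minorForm n k l q) y =
      contract3 (hmrTensorOfList F n k l) y i j * contract3 (hmrTensorOfList F n k l) y i' j' -
        contract3 (hmrTensorOfList F n k l) y i j' * contract3 (hmrTensorOfList F n k l) y i' j := by
  simp only [quadFormOfList, contract3_apply, hmrTensorOfList]
  rw [Finset.sum_mul_sum, Finset.sum_mul_sum, ← Finset.sum_sub_distrib]
  refine Finset.sum_congr rfl fun a _ => ?_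
  rw [← Finset.sum_sub_distrib]
  refine Finset.sum_congr rfl fun b _ => ?_
  have hs : a.1 * k + b.1 < k ^ 2 := by rw [sq]; exact rowMajor_lt a.2 b.2
  rw [minorForm, getD_map_range _ hs, (rowMajor_div_mod b.2).1, (rowMajor_div_mod b.2).2, minorCoeff,
    ← hi, ← hi', ← hj, ← hj']
  simp only [tEntry]
  push_cast
  ring

/-- The quadruple `(i, i', j, j') ∈ [n]⁴` is coded by `q = i n³ + i' n² + j n + j' < n⁴`.
[folklore] -/
private theorem code4 {n : ℕ} (i i' j j' : Fin n) :
    i.1 * n ^ 3 + i'.1 * n ^ 2 + j.1 * n + j'.1 < n ^ 4 ∧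
      (i.1 * n ^ 3 + i'.1 * n ^ 2 + j.1 * n + j'.1) / n ^ 3 = i.1 ∧
      (i.1 * n ^ 3 + i'.1 * n ^ 2 + j.1 * n + j'.1) / n ^ 2 % n = i'.1 ∧
      (i.1 * n ^ 3 + i'.1 * n ^ 2 + j.1 * n + j'.1) / n % n = j.1 ∧
      (i.1 * n ^ 3 + i'.1 * n ^ 2 + j.1 * n + j'.1) % n = j'.1 := by
  have hn : 0 < n := Fin.pos i
  set q := i.1 * n ^ 3 + i'.1 * n ^ 2 + j.1 * n + j'.1 with hq
  have hq1 : q = ((i.1 * n + i'.1) * n + j.1) * n + j'.1 := by rw [hq]; ring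
  have e1 : q / n = (i.1 * n + i'.1) * n + j.1 ∧ q % n = j'.1 := by rw [hq1]; exact rowMajor_div_mod j'.2
  have e2 : q / n ^ 2 = i.1 * n + i'.1 ∧ q / n % n = j.1 := by
    rw [sq, ← Nat.div_div_eq_div_mul, e1.1]; exact rowMajor_div_mod j.2
  have e3 : q / n ^ 3 = i.1 ∧ q / n ^ 2 % n = i'.1 := by
    rw [pow_succ, ← Nat.div_div_eq_div_mul, e2.1]; exact rowMajor_div_mod i'.2
  refine ⟨?_, e3.1, e3.2, e2.2, e1.2⟩
  have h1 : q < ((i.1 * n + i'.1) * n + j.1 + 1) * n := by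
    have e : ((i.1 * n + i'.1) * n + j.1 + 1) * n = ((i.1 * n + i'.1) * n + j.1) * n + n := by ring
    rw [hq1, e]; have := j'.2; omega
  have h2 : (i.1 * n + i'.1) * n + j.1 + 1 ≤ (i.1 * n + i'.1 + 1) * n := by
    have e : (i.1 * n + i'.1 + 1) * n = (i.1 * n + i'.1) * n + n := by ring
    rw [e]; have := j.2; omega
  have h3 : i.1 * n + i'.1 + 1 ≤ (i.1 + 1) * n := by
    have e : (i.1 + 1) * n = i.1 * n + n := by ring
    rw [e]; have := i'.2; omega
  have h4 : i.1 + 1 ≤ n := i.2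
  calc q < ((i.1 * n + i'.1) * n + j.1 + 1) * n := h1
    _ ≤ (i.1 * n + i'.1 + 1) * n * n := Nat.mul_le_mul_right _ h2
    _ ≤ (i.1 + 1) * n * n * n := Nat.mul_le_mul_right _ (Nat.mul_le_mul_right _ h3)
    _ ≤ n * n * n * n := Nat.mul_le_mul_right _ (Nat.mul_le_mul_right _ (Nat.mul_le_mul_right _ h4))
    _ = n ^ 4 := by ring

/-- **Rank `≤ 1` iff all the minor forms vanish** (for `k` unknowns `x` and the slices of `l`).
[cite: BlaserIkenmeyerLysikovPandeySchreyer2019, Thm. 34 (proof)] -/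
theorem rank_contract3_le_one_iff (n k : ℕ) (l : List ℤ) (y : Fin k → F) :
    (contract3 (hmrTensorOfList F n k l) y).rank ≤ 1 ↔
      ∀ q < n ^ 4, quadFormOfList F k (minorForm n k l q) y = 0 := by
  rw [Literature.LinearAlgebra.Matrix.rank_le_iff_det_submatrix_eq_zero]
  constructor
  · intro h q hq
    have hn : 0 < n := Nat.pos_of_ne_zero fun h0 => by rw [h0] at hq; simp at hq
    have hi : q / n ^ 3 < n := by
      rw [Nat.div_lt_iff_lt_mul (by positivity)]
      calc q < n ^ 4 := hq
        _ = n * n ^ 3 := by ring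
    have h2 := h ![⟨q / n ^ 3, hi⟩, ⟨q / n ^ 2 % n, Nat.mod_lt _ hn⟩]
      ![⟨q / n % n, Nat.mod_lt _ hn⟩, ⟨q % n, Nat.mod_lt _ hn⟩]
    rw [Matrix.det_fin_two] at h2
    rw [quadFormOfList_minorForm F n k l q y (i := ⟨q / n ^ 3, hi⟩) (i' := ⟨q / n ^ 2 % n, Nat.mod_lt _ hn⟩)
      (j := ⟨q / n % n, Nat.mod_lt _ hn⟩) (j' := ⟨q % n, Nat.mod_lt _ hn⟩) rfl rfl rfl rfl]
    simpa using h2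
  · intro h r c
    obtain ⟨hq, e1, e2, e3, e4⟩ := code4 (r 0) (r 1) (c 0) (c 1)
    have h2 := h _ hq
    rw [quadFormOfList_minorForm F n k l _ y e1.symm e2.symm e3.symm e4.symm] at h2
    rw [Matrix.det_fin_two]
    simpa using h2

/-- The fixed instance `(1, [[1]])` is a no-instance of `HQuad_ℤ` (`x_1² = 0` forces `x = 0`).
[cite: BlaserIkenmeyerLysikovPandeySchreyer2019, Problem 4] -/
theorem badA_not_mem : badA ∉ hquadZSet F := by
  simp only [badA, hquadZSet, Set.mem_setOf_eq, not_and, not_exists]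
  intro _ v hv hall
  have h : quadFormOfList F 1 [1] v = 0 := hall [1] (List.mem_singleton_self _)
  simp only [quadFormOfList, Fin.sum_univ_one, Fin.val_zero, zero_mul, add_zero,
    List.getD_cons_zero, Int.cast_one, one_mul] at h
  apply hv
  funext i
  rw [Subsingleton.elim i 0, Pi.zero_apply]
  exact mul_self_eq_zero.mp h

/-- **Correctness of the instance map**: `(n, k, l, r)` is a yes-instance of `HMinRank1` iff its
image is a yes-instance of `HQuad_ℤ` ("`HMinRank1` is a special case of `HQuad`", p0033:L82).
[cite: BlaserIkenmeyerLysikovPandeySchreyer2019, Thm. 34 (proof)] -/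
theorem mem_hmr1Set_iff_reduceA_mem (x : ℕ × ℕ × List ℤ × ℕ) : x ∈ hmr1Set F ↔ reduceA x ∈ hquadZSet F := by
  obtain ⟨n, k, l, r⟩ := x
  unfold reduceA
  by_cases hg : guardA (n, k, l, r) = true
  · rw [if_pos hg]
    simp only [guardA, Bool.and_eq_true, decide_eq_true_eq, Bool.not_eq_true', decide_eq_false_iff_not] at hg
    obtain ⟨⟨hwf, hr⟩, hk⟩ := hg
    simp only [hmr1Set, hquadZSet, instA, Set.mem_setOf_eq, HMRWellFormed, hwf, hr, true_and,
      mem_minrankSet_iff, List.forall_mem_map, List.mem_range, length_minorForm, implies_true]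
    refine exists_congr fun y => and_congr_right fun _ => ?_
    exact rank_contract3_le_one_iff F n k l y
  · rw [if_neg hg]
    refine ⟨fun h => (hg ?_).elim, fun h => (badA_not_mem F h).elim⟩
    obtain ⟨hwf, hr, y, hy, -⟩ := h
    simp only [guardA, Bool.and_eq_true, decide_eq_true_eq, Bool.not_eq_true', decide_eq_false_iff_not]
    refine ⟨⟨hwf, hr⟩, fun hk => hy ?_⟩
    dsimp only at hk y ⊢
    subst hk
    exact Subsingleton.elim _ _

end ReductionA

/-! ### §M. The machine: the instance map on codes, in the typed `CodeFP` algebra -/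

section MachineA

/-- The unary loop budget `(|l| + 2)²` (it dominates the number of forms `n⁴` and the number of
coefficients `k²` of a form when `|l| = k n²`, `k ≥ 1`). [cite: AroraBarak2009, §1.3 (polynomially bounded loops)] -/
def budgetA (x : ℕ × ℕ × List ℤ × ℕ) : ℕ := (x.2.2.1.length + 2) ^ 2

/-- A minor form tabulated under a budget `B` (equal to `minorForm` when `k² ≤ B`). [cite: AroraBarak2009, §1.3] -/
def minorFormC (n k : ℕ) (l : List ℤ) (B q : ℕ) : List ℤ :=
  (List.range (min (k ^ 2) B)).map fun s =>
    minorCoeff n l (q / n ^ 3) (q / n ^ 2 % n) (q / n % n) (q % n) (s / k) (s % k)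

/-- The instance tabulated under a budget `B` (equal to `instA` under the guard for `B = budgetA`).
[cite: AroraBarak2009, §1.3] -/
def instAC (x : ℕ × ℕ × List ℤ × ℕ) (B : ℕ) : ℕ × List (List ℤ) :=
  (x.2.1, (List.range (min (x.1 ^ 4) B)).map (minorFormC x.1 x.2.1 x.2.2.1 B))

/-- Under the guard the budget dominates both loop bounds, so the capped tables are the tables.
[folklore] -/
private theorem instAC_eq {x : ℕ × ℕ × List ℤ × ℕ} (hg : guardA x = true) : instAC x (budgetA x) = instA x := by
  obtain ⟨n, k, l, r⟩ := x
  simp only [guardA, Bool.and_eq_true, decide_eq_true_eq, Bool.not_eq_true', decide_eq_false_iff_not] at hg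
  obtain ⟨⟨hwf, -⟩, hk⟩ := hg
  by_cases hn : n = 0
  · subst hn
    simp [instAC, instA]
  have hk1 : 1 ≤ k := Nat.one_le_iff_ne_zero.2 hk
  have hn1 : 1 ≤ n ^ 2 := Nat.one_le_pow _ _ (Nat.pos_of_ne_zero hn)
  have hB4 : n ^ 4 ≤ budgetA (n, k, l, r) := by
    have h1 : n ^ 2 ≤ l.length + 2 := by
      rw [hwf]
      calc n ^ 2 = 1 * n ^ 2 := (one_mul _).symm
        _ ≤ k * n ^ 2 := Nat.mul_le_mul_right _ hk1
        _ ≤ k * n ^ 2 + 2 := Nat.le_add_right _ _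
    calc n ^ 4 = (n ^ 2) ^ 2 := by ring
      _ ≤ (l.length + 2) ^ 2 := Nat.pow_le_pow_left h1 2
  have hB2 : k ^ 2 ≤ budgetA (n, k, l, r) := by
    have h1 : k ≤ l.length + 2 := by
      rw [hwf]
      calc k = k * 1 := (mul_one _).symm
        _ ≤ k * n ^ 2 := Nat.mul_le_mul_left _ hn1
        _ ≤ k * n ^ 2 + 2 := Nat.le_add_right _ _
    exact Nat.pow_le_pow_left h1 2
  simp only [instAC, instA, min_eq_left hB4]
  congr 1
  refine List.map_congr_left fun q _ => ?_
  rw [minorFormC, minorForm, min_eq_left hB2]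

/-- The context of a coefficient: `(((n, k, l, r), q), s)` — instance, form number, position.
[cite: AroraBarak2009, §1.3] -/
abbrev ectxE : ((ℕ × ℕ × List ℤ × ℕ) × ℕ) × ℕ → List Bool := pairE (pairE instE natE) natE

/-- **The coefficient table on codes** (entries read by `rawGetOr`, arithmetic in the difference-pair
integer code). [cite: BlaserIkenmeyerLysikovPandeySchreyer2019, Thm. 34 (proof)] [cite: AroraBarak2009, §1.3] -/
theorem entryAFP : CodeFP ectxE smE (fun c => minorCoeff c.1.1.1 c.1.1.2.2.1 (c.1.2 / c.1.1.1 ^ 3)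
    (c.1.2 / c.1.1.1 ^ 2 % c.1.1.1) (c.1.2 / c.1.1.1 % c.1.1.1) (c.1.2 % c.1.1.1)
    (c.2 / c.1.1.2.1) (c.2 % c.1.1.2.1)) := by
  have hx : CodeFP ectxE instE (fun c => c.1.1) := (fst _ _).fst'
  have hn : CodeFP ectxE natE (fun c => c.1.1.1) := hx.fst'
  have hk : CodeFP ectxE natE (fun c => c.1.1.2.1) := hx.snd'.fst'
  have hl : CodeFP ectxE (rawE smE) (fun c => c.1.1.2.2.1) := ((rawOfList smE).comp hx.snd'.snd'.fst').congr fun _ => rfl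
  have hq : CodeFP ectxE natE (fun c => c.1.2) := (fst _ _).snd'
  have hs : CodeFP ectxE natE (fun c => c.2) := snd _ _
  have hn2 : CodeFP ectxE natE (fun c => c.1.1.1 ^ 2) := natPow.comp (hn.pair (const _ 2))
  have hn3 : CodeFP ectxE natE (fun c => c.1.1.1 ^ 3) := natPow.comp (hn.pair (const _ 3))
  have hi : CodeFP ectxE natE (fun c => c.1.2 / c.1.1.1 ^ 3) := natDiv.comp (hq.pair hn3)
  have hi' : CodeFP ectxE natE (fun c => c.1.2 / c.1.1.1 ^ 2 % c.1.1.1) :=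
    natMod.comp ((natDiv.comp (hq.pair hn2)).pair hn)
  have hj : CodeFP ectxE natE (fun c => c.1.2 / c.1.1.1 % c.1.1.1) := natMod.comp ((natDiv.comp (hq.pair hn)).pair hn)
  have hj' : CodeFP ectxE natE (fun c => c.1.2 % c.1.1.1) := natMod.comp (hq.pair hn)
  have ha : CodeFP ectxE natE (fun c => c.2 / c.1.1.2.1) := natDiv.comp (hs.pair hk)
  have hb : CodeFP ectxE natE (fun c => c.2 % c.1.1.2.1) := natMod.comp (hs.pair hk)
  -- entries `A_a[i, j] = l[a n² + i n + j]`
  have T : ∀ {ga gi gj : ((ℕ × ℕ × List ℤ × ℕ) × ℕ) × ℕ → ℕ}, CodeFP ectxE natE ga → CodeFP ectxE natE gi →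
      CodeFP ectxE natE gj → CodeFP ectxE intE (fun c => tEntry c.1.1.1 c.1.1.2.2.1 (ga c) (gi c) (gj c)) :=
    fun hga hgi hgj => (intOfSM.comp ((rawGetOr smE).comp (hl.pair ((natAdd.comp ((natAdd.comp
      ((natMul.comp (hga.pair hn2)).pair (natMul.comp (hgi.pair hn)))).pair hgj)).pair (const _ (0 : ℤ)))))).congr
        fun _ => rfl
  have hc : CodeFP ectxE intE (fun c => minorCoeff c.1.1.1 c.1.1.2.2.1 (c.1.2 / c.1.1.1 ^ 3)
      (c.1.2 / c.1.1.1 ^ 2 % c.1.1.1) (c.1.2 / c.1.1.1 % c.1.1.1) (c.1.2 % c.1.1.1)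
      (c.2 / c.1.1.2.1) (c.2 % c.1.1.2.1)) :=
    (intSub.comp ((intMul.comp ((T ha hi hj).pair (T hb hi' hj'))).pair
      (intMul.comp ((T ha hi hj').pair (T hb hi' hj))))).congr fun _ => rfl
  exact (smOfInt.comp hc).congr fun _ => rfl

/-- **The unary budget on codes.** [cite: AroraBarak2009, §1.3] -/
theorem budgetAFP : CodeFP instE (rawE unitE) (fun x => List.replicate (budgetA x) ()) :=
  ((unitsPow 2).comp (unSucc.comp (unSucc.comp ((ulength smE).comp ((rawOfList smE).comp
    (snd _ _).snd'.fst'))))).congr fun _ => rfl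

/-- **One minor form on codes** (a bounded range of positions mapped through the coefficient table,
then headed). [cite: BlaserIkenmeyerLysikovPandeySchreyer2019, Thm. 34 (proof)] [cite: AroraBarak2009, §1.3] -/
theorem formAFP : CodeFP (pairE instE natE) (listE smE)
    (fun d => minorFormC d.1.1 d.1.2.1 d.1.2.2.1 (List.replicate (budgetA d.1) ()).length d.2) := by
  have hk : CodeFP (pairE instE natE) natE (fun d => d.1.2.1) := (fst _ _).snd'.fst'
  have hB : CodeFP (pairE instE natE) (rawE unitE) (fun d => List.replicate (budgetA d.1) ()) :=
    budgetAFP.comp (fst _ _)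
  have hrange : CodeFP (pairE instE natE) (rawE natE)
      (fun d => List.range (min (d.1.2.1 ^ 2) (List.replicate (budgetA d.1) ()).length)) :=
    (brange unitE).comp (hB.pair (natPow.comp (hk.pair (const _ 2))))
  exact ((listOfRaw smE).comp ((CodeFP.map entryAFP).comp ((CodeFP.id _).pair hrange))).congr fun _ => rfl

/-- **The capped instance on codes.** [cite: BlaserIkenmeyerLysikovPandeySchreyer2019, Thm. 34 (proof)] [cite: AroraBarak2009, §1.3] -/
theorem instACFP : CodeFP instE quadE (fun x => instAC x (List.replicate (budgetA x) ()).length) := by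
  have hn : CodeFP instE natE (fun x => x.1) := fst _ _
  have hk : CodeFP instE natE (fun x => x.2.1) := (snd _ _).fst'
  have hrange : CodeFP instE (rawE natE)
      (fun x => List.range (min (x.1 ^ 4) (List.replicate (budgetA x) ()).length)) :=
    (brange unitE).comp (budgetAFP.pair (natPow.comp (hn.pair (const _ 4))))
  have hforms : CodeFP instE (listE (listE smE))
      (fun x => (List.range (min (x.1 ^ 4) (List.replicate (budgetA x) ()).length)).map
        (minorFormC x.1 x.2.1 x.2.2.1 (List.replicate (budgetA x) ()).length)) :=
    ((listOfRaw (listE smE)).comp ((CodeFP.map formAFP).comp ((CodeFP.id _).pair hrange))).congr fun _ => rfl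
  exact (hk.pair hforms).congr fun _ => rfl

/-- **The guard on codes.** [cite: BlaserIkenmeyerLysikovPandeySchreyer2019, Problem 3] [cite: AroraBarak2009, §1.3] -/
theorem guardAFP : CodeFP instE bitE guardA := by
  have hn : CodeFP instE natE (fun x => x.1) := fst _ _
  have hk : CodeFP instE natE (fun x => x.2.1) := (snd _ _).fst'
  have hl : CodeFP instE (rawE smE) (fun x => x.2.2.1) := ((rawOfList smE).comp (snd _ _).snd'.fst').congr fun _ => rfl
  have hr : CodeFP instE natE (fun x => x.2.2.2) := (snd _ _).snd'.snd'
  have h1 : CodeFP instE bitE (fun x => decide (x.2.2.1.length = x.2.1 * x.1 ^ 2)) :=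
    natEq.comp (((natLength smE).comp hl).pair (natMul.comp (hk.pair (natPow.comp (hn.pair (const _ 2))))))
  have h2 : CodeFP instE bitE (fun x => decide (x.2.2.2 = 1)) := natEq.comp (hr.pair (const _ 1))
  have h3 : CodeFP instE bitE (fun x => decide (x.2.1 = 0)) := natEq.comp (hk.pair (const _ 0))
  exact ((h1.and h2).and h3.not).congr fun _ => rfl

/-- **The instance map `reduceA` is computed on codes by a polynomial-time string function.**
[cite: BlaserIkenmeyerLysikovPandeySchreyer2019, Thm. 34] [cite: AroraBarak2009, §1.3] -/
theorem reduceAFP : CodeFP instE quadE reduceA := by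
  refine ((guardAFP.ite instACFP (const _ badA)).congr fun x => ?_)
  unfold reduceA
  by_cases h : guardA x = true
  · rw [if_pos h, if_pos h, List.length_replicate, instAC_eq h]
  · rw [if_neg h, if_neg h]

end MachineA

/-! ### §R. `HMinRank1 ≤ₚ HQuad_ℤ` -/

section ResultA

variable (F : Type u) [Field F]

/-- **BILPS Thm 34, first reduction: `HMinRank1_{ℤ,F} ≤ₚ HQuad_{ℤ,F}`** for every field `F` — the
printed Karp map ("`rk(Tx) ≤ 1` if and only if all `2 × 2` minors of `Tx` vanish", p0033:L80) on
codes, non-codes going to a fixed non-member. [cite: BlaserIkenmeyerLysikovPandeySchreyer2019, Thm. 34] -/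
theorem hmr1Language_karpReducible_hquadZLanguage : hmr1Language F ≤ₚ hquadZLanguage F := by
  rw [hmr1Language_eq, hquadZLanguage_eq]
  refine karpReducible_of_decoder tensorInstEncoding hquadInstEncoding (dec := decT) (fun x => ?_) ?_
    (g := reduceA) ?_ (mem_hmr1Set_iff_reduceA_mem F) (badA_not_mem F)
  · rw [instE_eq]; exact decT_instE x
  · rw [instE_eq]; exact decT_codeFP
  · rw [instE_eq, quadE_eq]; exact reduceAFP

end ResultA

end BILPS19Thm34

end Literature.Barriers.ValiantsHypothesis
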